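import Literature.MathematicalPhysics.QuantumFieldTheory.Balaban1983to89.B9Eq372RemLetters
import Literature.MathematicalPhysics.QuantumFieldTheory.Balaban1983to89.B9Eq382V3Operator

/-!
# `Balaban1983to89.B9Eq382V3Letters` — B9 p. 407 (3.82) «Δ_a(U′U) = … = Δ_a(U) − V₁(A) + (Δ′(U′U) − Δ′(U)) − V₂(A) − … = Δ_a(U) −
# V₃(A) − P₁(A) − P₂(A)» and «The operator V₃(A) is a local differential operator of the first order satisfying the bound (3.73)», with
# p. 404 «for the difference Δ′(U′U) − Δ′(U) we have a bound similar to (3.69), but with additional factor α₁»: THE FULL `V₃(A)` AS AN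
# ℝ-LINEAR LETTER IN GRADIENT FORM on the bond carrier and the curvature difference `Δ′(U′U) − Δ′(U)` AS A ZEROTH-ORDER LETTER WITH A
# BLOCK MAJORANT `O(1)α₁(Lʲη)⁻²e^{−δd}` — the `hV₃′`/`hV₃`/`hV0`/`hV1` hypotheses of the G-side devices (`B9Ineq386CommSum`) for the
# CONCRETE perturbation of (3.82), fourth file of the G-side twin (`B9Eq371GradLetters`, `B9Eq375GradLetters`, `B9Eq372RemLetters`)

statement-level skeleton of published theorems with citation tags; proofs where landed; nothing here is a claim about the Yang–Mills mass gap

CITATION HEADER (lean-in-tree rule).  T. Bałaban, *Propagators for lattice gauge theories in a background field*, Commun. Math. Phys.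
**99** (1985) 389–434 [Balaban1985BackgroundPropagators] (cell paper B9; held `paper:balaban1985-cmp99-background-propagators`, journal
page = PDF page + 388), p. 404 [PDF 16] and p. 407 [PDF 19], read by this seat on the materialised text pages p0016/p0019 and the renders
`b2b-balaban-ref1/pages/…-p016-x2.png`, `…-p019-x2.png` (2026-08-21).  THE PRINT (verbatim): p. 407 «Combining the expansions (3.71),
(3.76) and (3.80) we get Δ_a(U′U) = D*_{U′U}D_{U′U} + Δ′(U′U) + D_{U′U}R(U′U)D*_{U′U} + Q*(U′U)aQ(U′U) = Δ_a(U) − V₁(A) + (Δ′(U′U) − Δ′(U))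
− V₂(A) − P₁(A) + F₂*(A)aQ(U) + Q*(U)aF₂(A) + F₂*(A)aF₂(A) = Δ_a(U) − V₃(A) − P₁(A) − P₂(A). (3.82) The operator V₃(A) is a local
differential operator of the first order satisfying the bound (3.73).»; p. 404 «From the formula (3.10) it follows that Δ′(U′U) is a
small perturbation itself in the sense that we have the bound |(Δ′(U′U)A′)(b)| ≦ O(1)(Mα₀ + α₁)(Lʲη)⁻²|A′|, b ∈ Ω_j (3.69) the supremum on
the right-hand side is taken over bonds belonging to one of the plaquettes containing the bond b […]. It is easy to see that for the
difference Δ′(U′U) − Δ′(U) we have a bound similar to (3.69), but with additional factor α₁.»; (3.35) p. 396 (regularity of `U`), (3.37)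
p. 396 «|A′| < α₁(Lʲη)⁻¹, |∇^η_U A′| < α₁(Lʲη)⁻² on Ω_j».  [4] = T. Bałaban, *Propagators and renormalization transformations for lattice
gauge theories. II*, Commun. Math. Phys. **96** (1984) 223–250 [Balaban1984PropagatorsII], (2.51)–(2.52) p. 232.  Cell `lit-balaban`,
seat r06 (B9 fold owner) gen 10; SKELETON rows **B9.Eq3.82** × **B9.Eq3.69** × B9.Eq3.85 × B9.Thm3.4.

SIBLINGS REUSED BY NAME (imported; nothing restated): pv27's `B9Eq373V3` — the two-configuration machinery and THE DIFFERENCE BOUND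
`eq369_diff` (its §3 constants `kP`, `kΔ`, `budget_diff`/`norm_plaqU_prodCfg_sub_plaqU_le_printed`, `norm_R_prodCfg_sub_le`, the abstract
`norm_deltaPrimeOp_sub_le_local`, the configuration-locality `deltaPrimeOp_congr_cfg`/`agree_through_of_stBonds`/`prodCfg_congr_pt`,
`through_or_card_le`, and `V₃val` = `(V₃(A)A′)(b)` at the printed scale), `B9Eq382V3Operator.deltaPrimeLin` (Δ′(V) as a ℂ-linear
operator) and `kΔ_nonneg`, `B9Eq369Small` (`Through` = «p ∈ st(b)», plaquette-weight bounds), `B9Eq369Product` (`norm_prodCfg_le`),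
`B9Eq372Locality` (`stBonds`, `pBonds`, `mem_stBonds_iff`), `B9Eq386Neumann.vThree`; this seat's files 1–3 (`bondCarrierEnd`, `V₁Op`, `V₂Op`,
`F₁Letter`, `F₂Letter`, `zeroLetter(₂)`, `V1Letter(₂)`, their majorants and gradient forms); gen 8's `diffLetter`, `conj`, seam lemma
`hasMajorant_conj_of_local`.

WHAT THIS FILE PROVES (0 sorry; defs with bodies + theorems; no `def … : Prop`).
* §1 `dPrimeLetter V η := bondCarrierEnd (deltaPrimeLin V η)` — `Δ′(V)` of (3.10) as an ℝ-linear letter on the bond carrier (printed scale),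
  for ANY configuration `V`; **`V₃Op η A := V₁Op η A − (dPrimeLetter (U′U) η − dPrimeLetter U η) + V₂Op η A`** — THE FULL `V₃(A)` of
  (3.82); **`V₃Op_apply`**: `(V₃Op A)(A′)(μ,x) = V₃val … A′ μ x` (pv27's bond value, = `B9Eq382V3Operator.V₃L_apply`'s value);
  **`conj_V₃Op_eq_vThree`**: after real coordinates `conj b V₃Op = vThree (conj b V₁Op) (conj b V₂Op) (conj b Δ′(U)) (conj b Δ′(U′U))` —
  the `hV₃′` hypothesis of `B9Ineq386CommSum.thm34_G_entries13_opForm_of_comm_sum` AS A DEFINITIONAL IDENTITY; **`conj_V₃Op_eq_gradForm`**: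
  `conj b V₃Op = V0 + Σ_{k∈κ⊕κ} V1_k·D_k` with `V0 := conj b (zeroLetter η⁻¹ A + F₁Letter η A) − conj b (Δ′(U′U) − Δ′(U)) + conj b
  (zeroLetter₂ η⁻¹ A + F₂Letter η A)`, `V1_k := conj b (V1Letter A k) + conj b (V1Letter₂ A k)`, `D_k := conj b (∇_k)` — the `hV₃` shape
  («a local differential operator of the first order»).
* §2 **`eq369_diff_local`** — pv27's `B9Eq373V3.eq369_diff` («a bound similar to (3.69), but with additional factor α₁»:
  `‖(Δ′(U′U)A′)(b) − (Δ′(U)A′)(b)‖ ≦ (d − 1)·α₁·k_Δ(α₁, C₀)·(Lʲη)⁻²·|A′|`) WITH THE HYPOTHESES ON THE EXPONENT FIELD `A` READ ON `st(b)`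
  ONLY (`‖A(b′)‖ ≦ α₁(Lʲη)⁻¹` for `b′ ∈ stBonds(b)`, the two plaquette derivatives `≦ η·α₁(Lʲη)⁻²` on the plaquettes through `b`) instead
  of on all bonds — the form the multi-scale block calculus needs (different blocks, different `j`).  Proof = truncation of `A` to
  `stBonds(b)` (pv27's configuration-locality `deltaPrimeOp_congr_cfg`: `Δ′(U′U)` at `b` sees `U′U` on the plaquettes through `b` only)
  followed by pv27's script verbatim.
* §3 **`hasMajorant_dPrimeDiff`** — THE CURVATURE THIRD OF `V₃` AS A ZEROTH-ORDER BLOCK MAJORANT: for a group-valued background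
  (`‖U(b′)^{±1}‖ ≦ 1`) with (3.35) read as `‖U(∂p) − 1‖ ≦ C₀·L^{−2j(y)}` on the plaquettes through `b ∈ B(y)`, (3.37) for `A` on `st(b)` at
  the scale of `y`, lattice spacing `η = g.eta` (so `Lʲη = g.len y`), and the stencil geometry (`d(y, y(b′)) ≦ d₀` on `st(b)`, `d(y,y) ≦
  d₀`): `conj b (dPrimeLetter (U′U) − dPrimeLetter U) ≺ ((d−1)·k_Δ(α₁,C₀)·M₂(Σ‖b_i‖)e^{δd₀})·α₁·(Lʲη)⁻²·e^{−δd(y,y′)}` (§2 + gen 8's seam lemma).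
* §4 THE DEVICE INPUTS FOR THE CONCRETE `V₃` at `η = g.eta`, group-valued `U`: **`hasMajorant_V₃_one`** (`hV1`: `V1_k ≺ 14(d+1)·M₂(Σ‖b_i‖)
  e^{δd₀}·α₁(Lʲη)⁻¹e^{−δd}`, files 1–2 at `ρ = 1`) and **`hasMajorant_V₃_zero`** (`hV0`: `V0 ≺ (4d + 8d·growth(1/4)·α₁ + (d−1)k_Δ(α₁,C₀) + 6d +
  4d·growth(1/4)·α₁)·M₂(Σ‖b_i‖)e^{δd₀}·α₁(Lʲη)⁻²e^{−δd}`, files 1–3 at `ρ = 1` + §3) — i.e. (3.73) for `V₃(A)` IN THE BLOCK CALCULUS with every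
  `O(1)` explicit.

HONEST SCOPE / NOT CLAIMED.  (i) The device `B9Ineq386CommSum.thm34_G_entries13_opForm_of_comm_sum` also wants `h376`/`h380`/`hP₁`/`hP₂`
((3.76)–(3.81): `P₁(A)`, `P₂(A)`), the commutator majorants `hComm` (`[V1_k, ∇_k]` — for the mixing letters these meet the plaquette
curvature of `U`) and Theorem 3.3 for `G(U)`; NOT supplied here — with this file the `V₃`-side inputs (`hV₃`, `hV₃′`, `h371`, `hV0`, `hV1`)
are theorems, the rest stays hypotheses of the device (successor work).  (ii) §3–§4 are for a GROUP-VALUED background (`‖U^{±1}‖ ≦ 1`, the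
print's unitary `U`; pv27's constants `k_P`, `k_Δ` are derived at transport size `e^{α₁}`), at `η = g.eta`; (3.35) enters as the
plaquette bound `C₀L^{−2j}` with `C₀` a binder (the print's `O(1)(Mα₀ + α₁)`), (3.37) blockwise on `st(b)` at the OUTPUT block's scale;
the block distances of the stencils are hypotheses.  (iii) READING (pv27 D-pv27.14, LOW, inherited): the factor `α₁` of the difference
appears IN PLACE OF (3.69)'s `(Mα₀ + α₁)`, `C₀` re-entering inside `k_Δ`.  (iv) Operator (block-majorant) form after real coordinates
`(κ × S) × ι`; abstract carrier as in the companions; `[LinearOrder κ]` (the print's ordered directions, needed by `Δ′`).  Value = the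
`V₃`-side of (3.82)/(3.85) in the exact shapes the devices consume; NOT summit progress.

RELATED IN THE TREE, NOT DUPLICATED (searched 2026-08-21: `lean search --decl 'dPrimeLetter|V₃Op\b|eq369_diff_local|hasMajorant_dPrimeDiff|cV0\b'`
= ∅): pv27's `B9Eq373V3.eq369_diff`/`eq373_V₃` are the POINTWISE bounds with GLOBAL (3.37) hypotheses on `A` and `B9Eq382V3Operator.
opNorm_V₃L_le` the sup-OPERATOR-NORM form — §2 is the st(b)-local variant the block calculus needs (stated, proved by truncation + their
script, credited), §3–§4 are BLOCK majorants ([4] (2.51)) which the tree did not have for `Δ′(U′U) − Δ′(U)` or `V₃`.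
-/

noncomputable section

namespace Literature.MathematicalPhysics.QuantumFieldTheory.Balaban1983to89.B9Eq382V3Letters

open NormedSpace Complex
open Literature.MathematicalPhysics.QuantumFieldTheory.Balaban1983to89
open Literature.MathematicalPhysics.QuantumFieldTheory.Balaban1983to89.B6RandomWalk (HasMajorant hasMajorant_mono hasMajorant_add)
open Literature.MathematicalPhysics.QuantumFieldTheory.Balaban1983to89.B9Thm34Ext (toB6)
open Literature.MathematicalPhysics.QuantumFieldTheory.Balaban1983to89.B9Eq39Adjoint
open Literature.MathematicalPhysics.QuantumFieldTheory.Balaban1983to89.B9Eq310Hermitian (deltaPrimeOp zP yP)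
open Literature.MathematicalPhysics.QuantumFieldTheory.Balaban1983to89.B9Eq369Small
open Literature.MathematicalPhysics.QuantumFieldTheory.Balaban1983to89.B9Eq369Product (norm_prodCfg_le)
open Literature.MathematicalPhysics.QuantumFieldTheory.Balaban1983to89.B9Eq372Locality (stBonds pBonds mem_stBonds_iff)
open Literature.MathematicalPhysics.QuantumFieldTheory.Balaban1983to89.B9Eq373V3
open Literature.MathematicalPhysics.QuantumFieldTheory.Balaban1983to89.B9Eq382V3Operator (deltaPrimeLin kΔ_nonneg)
open Literature.MathematicalPhysics.QuantumFieldTheory.Balaban1983to89.B9Eq386Neumann (vThree)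
open Literature.MathematicalPhysics.QuantumFieldTheory.Balaban1983to89.B9Eq352DivForm (tauF tauB)
open Literature.MathematicalPhysics.QuantumFieldTheory.Balaban1983to89.B9Eq352DivFormLetters
open Literature.MathematicalPhysics.QuantumFieldTheory.Balaban1983to89.B9Eq352GradLetters (diffLetter conj_add)
open Literature.MathematicalPhysics.QuantumFieldTheory.Balaban1983to89.B9Eq371GradLetters (bT bU zeroLetter V1Letter
  hasMajorant_zeroLetter hasMajorant_V1Letter)
open Literature.MathematicalPhysics.QuantumFieldTheory.Balaban1983to89.B9Eq375GradLetters (zeroLetter₂ V1Letter₂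
  hasMajorant_zeroLetter₂ hasMajorant_V1Letter₂)
open Literature.MathematicalPhysics.QuantumFieldTheory.Balaban1983to89.B9Eq372RemLetters

/-! ## §1  `Δ′(V)` as a letter and the full `V₃(A)` in gradient form -/

section Letters

variable {𝔸 : Type*} [NormedRing 𝔸] [NormedAlgebra ℂ 𝔸] [CompleteSpace 𝔸] {S : Type} {κ : Type} [Fintype κ] [LinearOrder κ]
variable (T : κ → Equiv.Perm S) (U : κ → S → 𝔸ˣ)

omit U in
/-- **`Δ′(V)` of (3.10) AS AN ℝ-LINEAR LETTER on the bond carrier** (printed scale), for ANY configuration `V`: the bond reading of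
pv27's `deltaPrimeLin`. [cite: Balaban1985BackgroundPropagators, (3.10) p.392 + (3.69) p.404 + (3.82) p.407] -/
def dPrimeLetter (V : κ → S → 𝔸ˣ) (η : ℝ) : Module.End ℝ (κ × S → 𝔸) := bondCarrierEnd (deltaPrimeLin T V η)

omit [CompleteSpace 𝔸] U in
/-- Unfolding `dPrimeLetter` to pv27's `deltaPrimeOp`. [cite: Balaban1985BackgroundPropagators, (3.10) p.392] -/
theorem dPrimeLetter_apply (V : κ → S → 𝔸ˣ) (η : ℝ) (F : κ × S → 𝔸) (p : κ × S) :
    dPrimeLetter T V η F p = deltaPrimeOp T V η (fun k z => F (k, z)) p.1 p.2 := rfl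

/-- **THE FULL `V₃(A)` OF (3.82) AS AN ℝ-LINEAR LETTER**: `V₃Op η A := V₁Op η A − (Δ′(U′U) − Δ′(U)) + V₂Op η A` (true units; the sign
pattern of the third member of (3.82) = `B9Eq386Neumann.vThree`). [cite: Balaban1985BackgroundPropagators, (3.82) p.407] -/
def V₃Op (η : ℝ) (A : κ → S → 𝔸) : Module.End ℝ (κ × S → 𝔸) :=
  V₁Op T U η A - (dPrimeLetter T (prodCfg U η A) η - dPrimeLetter T U η) + V₂Op T U η A

omit [CompleteSpace 𝔸] [Fintype κ] [LinearOrder κ] T U in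
/-- `(η⁻¹)²·(η²·X) = X`. [folklore] -/
private theorem invsq_smul_sq_smul {η : ℝ} (hη : η ≠ 0) (X : 𝔸) : (((η : ℂ)⁻¹) ^ 2) • (((η : ℂ) ^ 2) • X) = X := by
  have hη' : (η : ℂ) ≠ 0 := Complex.ofReal_ne_zero.mpr hη
  rw [smul_smul, show ((η : ℂ)⁻¹) ^ 2 * (η : ℂ) ^ 2 = 1 by field_simp, one_smul]

/-- **`V₃Op` IS pv27's `V₃(A)`**: `(V₃Op η A)(A′)(μ, x) = V₃val T U η A A′ μ x` (`B9Eq373V3.V₃val` = `η⁻²V₁op − (Δ′(U′U)A′ − Δ′(U)A′) +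
η⁻²V₂op`, the value packaged by `B9Eq382V3Operator.V₃L`). [cite: Balaban1985BackgroundPropagators, (3.82) p.407] -/
theorem V₃Op_apply {η : ℝ} (hη : η ≠ 0) (A : κ → S → 𝔸) (F : κ × S → 𝔸) (μ : κ) (x : S) :
    V₃Op T U η A F (μ, x) = V₃val T U η A (fun k z => F (k, z)) μ x := by
  rw [V₃val_eq, ← V₁Op_apply T U hη A F μ x, ← V₂Op_apply T U hη A F μ x, invsq_smul_sq_smul hη,
    invsq_smul_sq_smul hη]
  rfl

variable {ι : Type} [Fintype ι] (b : Module.Basis ι ℝ 𝔸)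

/-- **THE `hV₃′` HYPOTHESIS OF THE G-SIDE DEVICE AS AN IDENTITY**: after real coordinates `conj b V₃Op = vThree (conj b V₁Op) (conj b V₂Op)
(conj b Δ′(U)) (conj b Δ′(U′U))` (`vThree V₁ V₂ Δp Δp′ = V₁ − (Δp′ − Δp) + V₂`).
[cite: Balaban1985BackgroundPropagators, (3.82) p.407; Balaban1984PropagatorsII, (2.52) p.232] -/
theorem conj_V₃Op_eq_vThree (η : ℝ) (A : κ → S → 𝔸) :
    conj b (V₃Op T U η A)
      = vThree (conj b (V₁Op T U η A)) (conj b (V₂Op T U η A)) (conj b (dPrimeLetter T U η))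
          (conj b (dPrimeLetter T (prodCfg U η A) η)) := by
  unfold vThree V₃Op
  rw [conj_add, conj_sub, conj_sub]

/-- **THE `hV₃` SHAPE — `V₃(A)` IN GRADIENT FORM** («a local differential operator of the first order»): `conj b V₃Op = V0 + Σ_{k∈κ⊕κ}
V1_k·D_k` with `V0 = conj b (zeroLetter η⁻¹ A + F₁Letter η A) − conj b (Δ′(U′U) − Δ′(U)) + conj b (zeroLetter₂ η⁻¹ A + F₂Letter η A)`,
`V1_k = conj b (V1Letter A k) + conj b (V1Letter₂ A k)`, `D_k = conj b (∇_k)`.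
[cite: Balaban1985BackgroundPropagators, (3.82) p.407 + (3.73) p.405; Balaban1984PropagatorsII, (2.52) p.232] -/
theorem conj_V₃Op_eq_gradForm (η : ℝ) (A : κ → S → 𝔸) :
    conj b (V₃Op T U η A)
      = (conj b (zeroLetter T U ((η : ℂ)⁻¹) A + F₁Letter T U η A)
          - conj b (dPrimeLetter T (prodCfg U η A) η - dPrimeLetter T U η)
          + conj b (zeroLetter₂ T U ((η : ℂ)⁻¹) A + F₂Letter T U η A))
        + ∑ k ∈ Finset.univ, (conj b (V1Letter T U A k) + conj b (V1Letter₂ T U A k))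
            * conj b (diffLetter (bT T) (bU U) ((η : ℂ)⁻¹) k) := by
  set D := dPrimeLetter T (prodCfg U η A) η - dPrimeLetter T U η with hD
  rw [V₃Op, ← hD, conj_add, conj_sub, conj_V₁Op_eq_gradForm, conj_V₂Op_eq_gradForm]
  simp only [add_mul, Finset.sum_add_distrib]
  abel

end Letters

/-! ## §2  pv27's `eq369_diff` with the exponent field read on `st(b)` only -/

section Local

variable {𝔸 : Type*} [NormedRing 𝔸] [NormedAlgebra ℂ 𝔸] [CompleteSpace 𝔸] {S : Type} {κ : Type} [Fintype κ] [LinearOrder κ]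
variable (T : κ → Equiv.Perm S) (U : κ → S → 𝔸ˣ)

/-- **«for the difference Δ′(U′U) − Δ′(U) we have a bound similar to (3.69), but with additional factor α₁», LOCAL HYPOTHESES**: pv27's
`B9Eq373V3.eq369_diff` — for a group-valued background (`‖U(b′)^{±1}‖ ≦ 1`), `L ≧ 1`, `η > 0`, `α₁ ≧ 0`, (3.35) as `‖U(∂p) − 1‖ ≦ C₀L^{−2j}`
and (3.37)-type `‖A′(b′)‖ ≦ a′` on the plaquettes through `b` — but with the exponent field `A` bounded ON `st(b)` ONLY: `‖A(b′)‖ ≦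
α₁(Lʲη)⁻¹` for `b′ ∈ stBonds(b)` and the two plaquette derivatives `‖(D¹_{U,m}A_n)(y)‖, ‖(D¹_{U,n}A_m)(y)‖ ≦ η·α₁(Lʲη)⁻²` for every
plaquette `p_{mn}(y)` through `b`: `‖(Δ′(U′U)A′)(b) − (Δ′(U)A′)(b)‖ ≦ (d − 1)·α₁·k_Δ(α₁, C₀)·(Lʲη)⁻²·a′`.  Proof: replace `A` by its
truncation to `stBonds(b)` (same `Δ′(U′U)A′` at `b` by pv27's `deltaPrimeOp_congr_cfg`), then pv27's script verbatim.
[cite: Balaban1985BackgroundPropagators, p.404 after (3.69); (3.35), (3.37) p.396] -/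
theorem eq369_diff_local {η L α₁ C₀ a' : ℝ} {j : ℕ} (hη : 0 < η) (hL : 1 ≤ L) (hα : 0 ≤ α₁)
    (hU : ∀ m z, ‖(U m z : 𝔸)‖ ≤ 1) (hU' : ∀ m z, ‖(((U m z)⁻¹ : 𝔸ˣ) : 𝔸)‖ ≤ 1)
    (A A' : κ → S → 𝔸) (μ : κ) (x : S)
    (hA : ∀ m z, (m, z) ∈ stBonds T μ x → ‖A m z‖ ≤ α₁ * (L ^ j * η)⁻¹)
    (hdA : ∀ m n y, Through T μ x m n y →
      ‖covD T U m (A n) y‖ ≤ η * (α₁ * ((L ^ j * η)⁻¹) ^ 2) ∧ ‖covD T U n (A m) y‖ ≤ η * (α₁ * ((L ^ j * η)⁻¹) ^ 2))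
    (hA' : ∀ m n y, Through T μ x m n y → ‖A' m y‖ ≤ a' ∧ ‖A' n (T m y)‖ ≤ a' ∧ ‖A' m (T n y)‖ ≤ a' ∧ ‖A' n y‖ ≤ a')
    (h35 : ∀ m n y, Through T μ x m n y → ‖(plaqU T U m n y : 𝔸) - 1‖ ≤ C₀ * ((L ^ j)⁻¹) ^ 2) :
    ‖deltaPrimeOp T (prodCfg U η A) η A' μ x - deltaPrimeOp T U η A' μ x‖
      ≤ ((Fintype.card κ - 1 : ℕ) : ℝ) * (α₁ * kΔ α₁ C₀ * ((L ^ j * η) ^ 2)⁻¹ * a') := by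
  classical
  -- truncation of the exponent field to `st(b)`
  set Al : κ → S → 𝔸 := fun m z => if (m, z) ∈ stBonds T μ x then A m z else 0 with hAl
  have hAl_eq : ∀ m z, (m, z) ∈ stBonds T μ x → Al m z = A m z := fun m z h => by simp only [hAl, if_pos h]
  have hswap : deltaPrimeOp T (prodCfg U η A) η A' μ x = deltaPrimeOp T (prodCfg U η Al) η A' μ x :=
    deltaPrimeOp_congr_cfg T η A' μ x
      (agree_through_of_stBonds T fun m z hmz => prodCfg_congr_pt U η (hAl_eq m z hmz).symm)
  rw [hswap]
  -- the truncated field obeys (3.37) everywhere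
  set a := α₁ * (L ^ j * η)⁻¹ with ha_def
  have hpos : 0 < L ^ j * η := mul_pos (pow_pos (by linarith) j) hη
  have ha0 : 0 ≤ a := by rw [ha_def]; positivity
  have hAg : ∀ m z, ‖Al m z‖ ≤ a := by
    intro m z
    by_cases h : (m, z) ∈ stBonds T μ x
    · rw [hAl_eq m z h]; exact hA m z h
    · simp only [hAl, if_neg h, norm_zero]; exact ha0
  have ha : a ≤ α₁ * (L ^ j * η)⁻¹ := le_rfl
  have hdAl : ∀ m n y, Through T μ x m n y →
      ‖covD T U m (Al n) y‖ ≤ η * (α₁ * ((L ^ j * η)⁻¹) ^ 2) ∧ ‖covD T U n (Al m) y‖ ≤ η * (α₁ * ((L ^ j * η)⁻¹) ^ 2) := by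
    intro m n y h
    have hm : ∀ q, q ∈ pBonds T m n y → q ∈ stBonds T μ x := fun q hq => mem_stBonds_iff.mpr ⟨m, n, y, h, hq⟩
    have e1 : Al n (T m y) = A n (T m y) := hAl_eq _ _ (hm _ (by simp [pBonds]))
    have e2 : Al n y = A n y := hAl_eq _ _ (hm _ (by simp [pBonds]))
    have e3 : Al m (T n y) = A m (T n y) := hAl_eq _ _ (hm _ (by simp [pBonds]))
    have e4 : Al m y = A m y := hAl_eq _ _ (hm _ (by simp [pBonds]))
    have c1 : covD T U m (Al n) y = covD T U m (A n) y := by simp only [covD, e1, e2]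
    have c2 : covD T U n (Al m) y = covD T U n (A m) y := by simp only [covD, e3, e4]
    rw [c1, c2]
    exact hdA m n y h
  -- pv27's script (`B9Eq373V3.eq369_diff`), with `A := Al`
  have hLj : 1 ≤ L ^ j := one_le_pow₀ hL
  set ξ := (L ^ j)⁻¹ with hξ
  have hξ0 : 0 < ξ := inv_pos.mpr (by linarith)
  have hξ1 : ξ ≤ 1 := inv_le_one_of_one_le₀ hLj
  have haξ : η * a ≤ α₁ * ξ := eta_mul_le_xi hη ha
  set E := Real.exp α₁ with hEdef
  have hE1 : 1 ≤ E := Real.one_le_exp hα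
  have hE2 : Real.exp (2 * α₁) = E ^ 2 := by rw [show 2 * α₁ = α₁ + α₁ by ring, Real.exp_add, hEdef]; ring
  have hU1 : ∀ m z, ‖(U m z : 𝔸)‖ ≤ 1 ∧ ‖(((U m z)⁻¹ : 𝔸ˣ) : 𝔸)‖ ≤ 1 := fun m z => ⟨hU m z, hU' m z⟩
  have hUρ : ∀ m z, ‖(U m z : 𝔸)‖ ≤ E ∧ ‖(((U m z)⁻¹ : 𝔸ˣ) : 𝔸)‖ ≤ E := fun m z => ⟨(hU m z).trans hE1, (hU' m z).trans hE1⟩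
  have hs : ∀ m z, η * ‖Al m z‖ ≤ α₁ * ξ := fun m z => (mul_le_mul_of_nonneg_left (hAg m z) hη.le).trans haξ
  have hs1 : ∀ m z, η * ‖Al m z‖ ≤ α₁ := fun m z => (hs m z).trans (by nlinarith)
  have hVρ : ∀ m z, ‖(prodCfg U η Al m z : 𝔸)‖ ≤ E ∧ ‖(((prodCfg U η Al m z)⁻¹ : 𝔸ˣ) : 𝔸)‖ ≤ E := by
    intro m z; simpa only [mul_one] using norm_prodCfg_le U hη.le hs1 hU1 m z
  set σ := 2 * (α₁ * ξ) * E ^ 2 with hσdef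
  have hσ0 : 0 ≤ σ := by rw [hσdef]; positivity
  have hσle : 1 ^ 2 * (Real.exp (2 * (α₁ * ξ)) - 1) ≤ σ := by
    rw [one_pow, one_mul, hσdef, ← hE2]
    exact exp_sub_one_le_mul_exp_of_le (by positivity) (by nlinarith)
  have hσ : ∀ m z X, ‖R (prodCfg U η Al m z) X - R (U m z) X‖ ≤ σ * ‖X‖ := fun m z X =>
    ((norm_R_prodCfg_sub_le U hη.le hs hU1 m z X).1).trans (mul_le_mul_of_nonneg_right hσle (norm_nonneg _))
  have hσ' : ∀ m z X, ‖R (prodCfg U η Al m z)⁻¹ X - R (U m z)⁻¹ X‖ ≤ σ * ‖X‖ := fun m z X =>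
    ((norm_R_prodCfg_sub_le U hη.le hs hU1 m z X).2).trans (mul_le_mul_of_nonneg_right hσle (norm_nonneg _))
  set Θ := (1 + E ^ 4) / 2 * kP α₁ C₀ with hΘdef
  set θ := (η ^ 2)⁻¹ * ξ ^ 2 * (α₁ * Θ) with hθdef
  set δ := (η ^ 2)⁻¹ * ξ ^ 2 * (C₀ + α₁ * Θ) with hδdef
  have hplaq : ∀ m n y, Through T μ x m n y →
      ‖(plaqU T (prodCfg U η Al) m n y : 𝔸) - (plaqU T U m n y : 𝔸)‖ ≤ α₁ * kP α₁ C₀ * ξ ^ 2 := fun m n y h =>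
    norm_plaqU_prodCfg_sub_plaqU_le_printed T U hη hL (hAg m y) (hAg n y) ha (hdAl m n y h).1 (hdAl m n y h).2 le_rfl
      (h35 m n y h)
  have hzθ : ∀ m n y, Through T μ x m n y → ‖zP T (prodCfg U η Al) η m n y - zP T U η m n y‖ ≤ θ := by
    intro m n y h
    refine (norm_zP_sub_zP_le T U (prodCfg U η Al) (norm_plaqU_inv_le T (prodCfg U η Al) hVρ m n y)
      (norm_plaqU_inv_le_one T U hU1 m n y) (hplaq m n y h)).trans (le_of_eq ?_)
    rw [hθdef, hΘdef]; ring
  have hyθ : ∀ m n y, Through T μ x m n y → ‖yP T (prodCfg U η Al) η m n y - yP T U η m n y‖ ≤ θ := by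
    intro m n y h
    refine (norm_yP_sub_yP_le T U (prodCfg U η Al) (norm_plaqU_inv_le T (prodCfg U η Al) hVρ m n y)
      (norm_plaqU_inv_le_one T U hU1 m n y) (hplaq m n y h)).trans (le_of_eq ?_)
    rw [hθdef, hΘdef]; ring
  have hC0θ : ∀ m n y, Through T μ x m n y → 0 ≤ C₀ ∧ 0 ≤ θ := by
    intro m n y h
    have hC0 : 0 ≤ C₀ := by nlinarith [(norm_nonneg _).trans (h35 m n y h), pow_pos hξ0 2]
    refine ⟨hC0, ?_⟩
    rw [hθdef, hΘdef]
    have := kP_nonneg hα hC0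
    positivity
  have hδU : ∀ m n y, Through T μ x m n y → ‖zP T U η m n y‖ ≤ δ ∧ ‖yP T U η m n y‖ ≤ δ := by
    intro m n y h
    obtain ⟨hC0, hθ0⟩ := hC0θ m n y h
    have e : (η ^ 2)⁻¹ * (C₀ * ξ ^ 2) ≤ δ := by
      rw [hδdef]
      have : (η ^ 2)⁻¹ * ξ ^ 2 * (C₀ + α₁ * Θ) = (η ^ 2)⁻¹ * (C₀ * ξ ^ 2) + θ := by rw [hθdef]; ring
      rw [this]; linarith
    exact ⟨(norm_zP_le_of_plaq_one T U hU1 (h35 m n y h)).trans e, (norm_yP_le_of_plaq_one T U hU1 (h35 m n y h)).trans e⟩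
  have hθδ : (η ^ 2)⁻¹ * (C₀ * ξ ^ 2) + θ = δ := by rw [hδdef, hθdef]; ring
  have hz : ∀ m n y, Through T μ x m n y → ‖zP T U η m n y‖ ≤ δ ∧ ‖zP T (prodCfg U η Al) η m n y‖ ≤ δ
      ∧ ‖zP T (prodCfg U η Al) η m n y - zP T U η m n y‖ ≤ θ := by
    intro m n y h
    refine ⟨(hδU m n y h).1, ?_, hzθ m n y h⟩
    have e : zP T (prodCfg U η Al) η m n y = zP T U η m n y + (zP T (prodCfg U η Al) η m n y - zP T U η m n y) := by abel
    rw [e, ← hθδ]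
    exact norm_add_le_of_le (norm_zP_le_of_plaq_one T U hU1 (h35 m n y h)) (hzθ m n y h)
  have hy : ∀ m n y, Through T μ x m n y → ‖yP T U η m n y‖ ≤ δ ∧ ‖yP T (prodCfg U η Al) η m n y‖ ≤ δ
      ∧ ‖yP T (prodCfg U η Al) η m n y - yP T U η m n y‖ ≤ θ := by
    intro m n y h
    refine ⟨(hδU m n y h).2, ?_, hyθ m n y h⟩
    have e : yP T (prodCfg U η Al) η m n y = yP T U η m n y + (yP T (prodCfg U η Al) η m n y - yP T U η m n y) := by abel
    rw [e, ← hθδ]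
    exact norm_add_le_of_le (norm_yP_le_of_plaq_one T U hU1 (h35 m n y h)) (hyθ m n y h)
  have main := norm_deltaPrimeOp_sub_le_local T U (prodCfg U η Al) hE1 hUρ hVρ hσ0 hσ hσ' μ x hA' hz hy
  refine main.trans ?_
  rcases through_or_card_le T μ x with ⟨m, n, y, h⟩ | hd
  · have ha' : 0 ≤ a' := (norm_nonneg _).trans (hA' m n y h).1
    obtain ⟨hC0, hθ0⟩ := hC0θ m n y h
    have hE0 : 0 < E := lt_of_lt_of_le one_pos hE1
    have hΘ0 : 0 ≤ Θ := by rw [hΘdef]; have := kP_nonneg hα hC0; positivity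
    have hcoef : 14 * E ^ 4 * θ + 15 * E ^ 2 * σ * δ ≤ α₁ * kΔ α₁ C₀ * ((η ^ 2)⁻¹ * ξ ^ 2) := by
      have e : α₁ * kΔ α₁ C₀ * ((η ^ 2)⁻¹ * ξ ^ 2) - (14 * E ^ 4 * θ + 15 * E ^ 2 * σ * δ)
          = 30 * α₁ * E ^ 4 * ((η ^ 2)⁻¹ * ξ ^ 2) * (C₀ + α₁ * Θ) * (1 - ξ) := by
        simp only [hθdef, hδdef, hσdef, hΘdef, hEdef, kΔ]; ring
      have hB : 0 ≤ 30 * α₁ * E ^ 4 * ((η ^ 2)⁻¹ * ξ ^ 2) * (C₀ + α₁ * Θ) := by positivity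
      have hnn := mul_nonneg hB (by linarith : 0 ≤ 1 - ξ)
      linarith
    calc (14 * E ^ 4 * θ + 15 * E ^ 2 * σ * δ) * a' * ((Fintype.card κ - 1 : ℕ) : ℝ)
        ≤ (α₁ * kΔ α₁ C₀ * ((η ^ 2)⁻¹ * ξ ^ 2)) * a' * ((Fintype.card κ - 1 : ℕ) : ℝ) := by gcongr
      _ = ((Fintype.card κ - 1 : ℕ) : ℝ) * (α₁ * kΔ α₁ C₀ * ((L ^ j * η) ^ 2)⁻¹ * a') := by
          rw [hξ, xi_sq_div_eta_sq]; ring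
  · rw [hd, mul_zero, zero_mul]

end Local

/-! ## §3  The curvature third of `V₃` as a zeroth-order block majorant -/

section Majorants

variable {𝔸 : Type*} [NormedRing 𝔸] [NormedAlgebra ℂ 𝔸] [CompleteSpace 𝔸] {ι : Type} [Fintype ι]
variable (b : Module.Basis ι ℝ 𝔸) {S : Type} {κ : Type} [Fintype κ] [LinearOrder κ]
variable (T : κ → Equiv.Perm S) (U : κ → S → 𝔸ˣ)
variable {g : B9.Geometry} [Fintype g.Site] {Rr : ℝ} {H : Prop}

omit [Fintype ι] [CompleteSpace 𝔸] b [Fintype κ] [LinearOrder κ] T U in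
/-- `−T` has the majorants of `T`. [folklore] -/
private theorem hasMajorant_neg' {X : Type} (blk : X → g.Site) {L : Module.End ℝ (X → ℝ)} {K : g.Site → g.Site → ℝ}
    (h : HasMajorant (g := toB6 g Rr H) blk L K) : HasMajorant (g := toB6 g Rr H) blk (-L) K := by
  intro y' μ B hμ x
  simpa using h y' μ B hμ x

omit [Fintype ι] [CompleteSpace 𝔸] b [Fintype κ] [LinearOrder κ] T U in
/-- A difference has the sum of the majorants ([4] p. 232 «A summation preserves it also»). [folklore] -/
private theorem hasMajorant_sub' {X : Type} (blk : X → g.Site) {L₁ L₂ : Module.End ℝ (X → ℝ)} {K₁ K₂ : g.Site → g.Site → ℝ}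
    (h₁ : HasMajorant (g := toB6 g Rr H) blk L₁ K₁) (h₂ : HasMajorant (g := toB6 g Rr H) blk L₂ K₂) :
    HasMajorant (g := toB6 g Rr H) blk (L₁ - L₂) (fun a a' => K₁ a a' + K₂ a a') := by
  rw [sub_eq_add_neg]
  exact hasMajorant_add (g := toB6 g Rr H) blk h₁ (hasMajorant_neg' (Rr := Rr) (H := H) blk h₂)

/-- **THE CURVATURE THIRD `Δ′(U′U) − Δ′(U)` OF `V₃` AS A ZEROTH-ORDER BLOCK MAJORANT** («a bound similar to (3.69), but with additional
factor α₁», block form): for a group-valued background (`‖U(b′)^{±1}‖ ≦ 1`), `L ≧ 1`, lattice spacing `η = g.eta > 0` (so `Lʲη = g.len y`),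
(3.35) read as `‖U(∂p) − 1‖ ≦ C₀·L^{−2j(y)}` on the plaquettes through `b ∈ B(y)`, (3.37) for the exponent field on `st(b)` at the scale
of `y` (`‖A(b′)‖ ≦ α₁(Lʲη)⁻¹`, plaquette derivatives `≦ η·α₁(Lʲη)⁻²`), and the stencil geometry (`d(y, y(b′)) ≦ d₀` for `b′ ∈ st(b)`,
`d(y,y) ≦ d₀`): `conj b (dPrimeLetter (U′U) − dPrimeLetter U) ≺ ((d−1)·k_Δ(α₁,C₀)·M₂(Σ‖b_i‖)e^{δd₀})·α₁·(Lʲη)⁻²·e^{−δd(y,y′)}`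
(§2 + gen 8's seam lemma; the A′-stencil is `{b} ∪ stBonds(b)`).
[cite: Balaban1985BackgroundPropagators, p.404 after (3.69) + (3.82) p.407; Balaban1984PropagatorsII, (2.51)–(2.52) p.232] -/
theorem hasMajorant_dPrimeDiff (blk : S → g.Site) (hη : 0 < g.eta) (hL : 1 ≤ g.L) (A : κ → S → 𝔸) (C₀ d₀ δ M₂ α₁ : ℝ)
    (hα₁ : 0 ≤ α₁) (hC₀ : 0 ≤ C₀) (hδ : 0 ≤ δ) (hM₂ : 0 ≤ M₂) (hrepr : ∀ (v : 𝔸) (i : ι), |b.repr v i| ≤ M₂ * ‖v‖)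
    (hU1 : ∀ m z, ‖((U m z : 𝔸ˣ) : 𝔸)‖ ≤ 1 ∧ ‖(((U m z)⁻¹ : 𝔸ˣ) : 𝔸)‖ ≤ 1)
    (hAst : ∀ μ x m z, (m, z) ∈ stBonds T μ x → ‖A m z‖ ≤ α₁ * (g.len (blk x))⁻¹)
    (hdAst : ∀ μ x m n y, Through T μ x m n y →
      ‖covD T U m (A n) y‖ ≤ g.eta * (α₁ * ((g.len (blk x))⁻¹) ^ 2) ∧
        ‖covD T U n (A m) y‖ ≤ g.eta * (α₁ * ((g.len (blk x))⁻¹) ^ 2))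
    (h35 : ∀ μ x m n y, Through T μ x m n y → ‖(plaqU T U m n y : 𝔸) - 1‖ ≤ C₀ * ((g.L ^ g.scale (blk x))⁻¹) ^ 2)
    (hd₀st : ∀ μ x (q : κ × S), q ∈ stBonds T μ x → g.dist (blk x) (blk q.2) ≤ d₀)
    (hd₀0 : ∀ y : g.Site, g.dist y y ≤ d₀) :
    HasMajorant (g := toB6 g Rr H) (fun q : (κ × S) × ι => blk q.1.2)
      (conj b (dPrimeLetter T (prodCfg U g.eta A) g.eta - dPrimeLetter T U g.eta))
      (fun y y' => (((Fintype.card κ - 1 : ℕ) : ℝ) * kΔ α₁ C₀ * M₂ * (∑ i, ‖b i‖) * Real.exp (δ * d₀)) * α₁ *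
        (g.len y ^ 2)⁻¹ * Real.exp (-(δ * g.dist y y'))) := by
  have hk : 0 ≤ kΔ α₁ C₀ := kΔ_nonneg hα₁ hC₀
  have hc0 : ∀ y : g.Site, 0 ≤ ((Fintype.card κ - 1 : ℕ) : ℝ) * α₁ * kΔ α₁ C₀ * (g.len y ^ 2)⁻¹ := fun y => by positivity
  refine hasMajorant_mono (g := toB6 g Rr H) _
    (hasMajorant_conj_of_local (Rr := Rr) (H := H) b (fun p : κ × S => blk p.2) (fun p q => q = p ∨ q ∈ stBonds T p.1 p.2)
      (fun y => ((Fintype.card κ - 1 : ℕ) : ℝ) * α₁ * kΔ α₁ C₀ * (g.len y ^ 2)⁻¹) d₀ δ M₂ hc0 hδ hM₂ hrepr ?_ _ ?_)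
    fun y y' => le_of_eq (by ring)
  · rintro p q (rfl | h)
    · exact hd₀0 _
    · exact hd₀st p.1 p.2 q h
  · intro F p B hB
    -- the A′-letters on the plaquettes through `b` are letters on `stBonds(b)`
    have hF : ∀ m n y, Through T p.1 p.2 m n y →
        ‖F (m, y)‖ ≤ B ∧ ‖F (n, T m y)‖ ≤ B ∧ ‖F (m, T n y)‖ ≤ B ∧ ‖F (n, y)‖ ≤ B := by
      intro m n y h
      have hm : ∀ q, q ∈ pBonds T m n y → q ∈ stBonds T p.1 p.2 := fun q hq => mem_stBonds_iff.mpr ⟨m, n, y, h, hq⟩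
      exact ⟨hB _ (Or.inr (hm _ (by simp [pBonds]))), hB _ (Or.inr (hm _ (by simp [pBonds]))),
        hB _ (Or.inr (hm _ (by simp [pBonds]))), hB _ (Or.inr (hm _ (by simp [pBonds])))⟩
    have h369 := eq369_diff_local T U (L := g.L) (j := g.scale (blk p.2)) hη hL hα₁ (fun m z => (hU1 m z).1)
      (fun m z => (hU1 m z).2) A (fun k z => F (k, z)) p.1 p.2 (hAst p.1 p.2) (hdAst p.1 p.2) hF (h35 p.1 p.2)
    rw [LinearMap.sub_apply, Pi.sub_apply, dPrimeLetter_apply, dPrimeLetter_apply]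
    refine h369.trans (le_of_eq ?_)
    show _ = ((Fintype.card κ - 1 : ℕ) : ℝ) * α₁ * kΔ α₁ C₀ * (g.len (blk p.2) ^ 2)⁻¹ * B
    simp only [B9.Geometry.len]
    ring

/-! ## §4  The device inputs `hV1`, `hV0` for the concrete `V₃` (group-valued background, `η = g.eta`) -/

omit [CompleteSpace 𝔸] in
/-- **`hV1` FOR THE CONCRETE `V₃`**: the first-order coefficient letters `V1_k = conj b (V1Letter A k) + conj b (V1Letter₂ A k)` (files 1–2 at
transport size `ρ = 1`) have `V1_k ≺ 14(d+1)·M₂(Σ‖b_i‖)e^{δd₀}·α₁(Lʲη)⁻¹·e^{−δd}` under (3.37) read blockwise for `A`, `τ*_νA`, `τ_μA`.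
[cite: Balaban1985BackgroundPropagators, (3.73) p.405 + (3.82) p.407; Balaban1984PropagatorsII, (2.51)–(2.52) p.232] -/
theorem hasMajorant_V₃_one (blk : S → g.Site) (A : κ → S → 𝔸) (d₀ δ M₂ α₁ : ℝ)
    (hα₁ : 0 ≤ α₁) (hδ : 0 ≤ δ) (hM₂ : 0 ≤ M₂) (hrepr : ∀ (v : 𝔸) (i : ι), |b.repr v i| ≤ M₂ * ‖v‖)
    (hlen : ∀ y : g.Site, 0 < g.len y)
    (hA : ∀ k x, ‖A k x‖ ≤ α₁ * (g.len (blk x))⁻¹) (hAτB : ∀ ν k x, ‖tauB T U ν (A k) x‖ ≤ α₁ * (g.len (blk x))⁻¹)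
    (hAτF : ∀ μ k x, ‖tauF T U μ (A k) x‖ ≤ α₁ * (g.len (blk x))⁻¹)
    (hU1 : ∀ μ x, ‖((U μ x : 𝔸ˣ) : 𝔸)‖ ≤ 1 ∧ ‖(((U μ x)⁻¹ : 𝔸ˣ) : 𝔸)‖ ≤ 1)
    (hd₀B : ∀ μ x, g.dist (blk x) (blk ((T μ).symm x)) ≤ d₀) (hd₀F : ∀ μ x, g.dist (blk x) (blk (T μ x)) ≤ d₀)
    (hd₀0 : ∀ y : g.Site, g.dist y y ≤ d₀) (k : κ ⊕ κ) :
    HasMajorant (g := toB6 g Rr H) (fun q : (κ × S) × ι => blk q.1.2)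
      (conj b (V1Letter T U A k) + conj b (V1Letter₂ T U A k))
      (fun y y' => (14 * (Fintype.card κ + 1) * M₂ * (∑ i, ‖b i‖) * Real.exp (δ * d₀)) * α₁ * (g.len y)⁻¹ *
        Real.exp (-(δ * g.dist y y'))) := by
  refine hasMajorant_mono (g := toB6 g Rr H) _
    (hasMajorant_add (g := toB6 g Rr H) _
      (hasMajorant_V1Letter (Rr := Rr) (H := H) b T U blk A 1 d₀ δ M₂ α₁ hα₁ hδ hM₂ hrepr hlen hA hAτB hU1 hd₀B hd₀0 k)
      (hasMajorant_V1Letter₂ (Rr := Rr) (H := H) b T U blk A 1 d₀ δ M₂ α₁ hα₁ hδ hM₂ hrepr hlen hA hAτF hU1 hd₀F hd₀0 k))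
    fun y y' => le_of_eq (by ring)

/-- THE ZEROTH-ORDER CONSTANT OF THE CONCRETE `V₃` (group-valued background): `c⁰_V(d, α₁, C₀) = 4d + 8d·growth(1/4)·α₁ + (d−1)·k_Δ(α₁,C₀)
+ 6d + 4d·growth(1/4)·α₁` (bracket `V⁰` of `V₁` + `F₁` + curvature difference + bracket `V⁰` of `V₂` + `F₂`, files 1–3 at `ρ = 1` and §3).
[cite: Balaban1985BackgroundPropagators, (3.73) p.405 + (3.82) p.407] -/
def cV0 (d : ℕ) (α₁ C₀ : ℝ) : ℝ :=
  4 * d + 8 * d * growth (1 / 4) * α₁ + ((d - 1 : ℕ) : ℝ) * kΔ α₁ C₀ + 6 * d + 4 * d * growth (1 / 4) * α₁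

/-- **`hV0` FOR THE CONCRETE `V₃`** — (3.73)'s `O(1)α₁(Lʲη)⁻²|A′|` part for `V₃(A)` IN THE BLOCK CALCULUS: the zeroth-order part
`V0 = conj b (zeroLetter η⁻¹ A + F₁Letter η A) − conj b (Δ′(U′U) − Δ′(U)) + conj b (zeroLetter₂ η⁻¹ A + F₂Letter η A)` of
`conj_V₃Op_eq_gradForm` has `V0 ≺ c⁰_V(d, α₁, C₀)·M₂(Σ‖b_i‖)e^{δd₀}·α₁(Lʲη)⁻²·e^{−δd}` at `η = g.eta`, for a group-valued background, under
(3.37) read blockwise on the stencils of files 1–3 and §3, (3.35) on the plaquettes through the output bond, `η·α₁(Lʲη)⁻¹ ≦ 1/4`, and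
the stencil geometry. [cite: Balaban1985BackgroundPropagators, (3.73) p.405 + (3.82) p.407 + p.404; Balaban1984PropagatorsII, (2.51)–(2.52) p.232] -/
theorem hasMajorant_V₃_zero (blk : S → g.Site) (hη : 0 < g.eta) (hL : 1 ≤ g.L) (A : κ → S → 𝔸) (C₀ d₀ δ M₂ α₁ : ℝ)
    (hα₁ : 0 ≤ α₁) (hC₀ : 0 ≤ C₀) (hδ : 0 ≤ δ) (hM₂ : 0 ≤ M₂) (hrepr : ∀ (v : 𝔸) (i : ι), |b.repr v i| ≤ M₂ * ‖v‖)
    (hlen : ∀ y : g.Site, 0 < g.len y) (hsmall : ∀ y : g.Site, g.eta * (α₁ * (g.len y)⁻¹) ≤ 1 / 4)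
    (hU1 : ∀ m z, ‖((U m z : 𝔸ˣ) : 𝔸)‖ ≤ 1 ∧ ‖(((U m z)⁻¹ : 𝔸ˣ) : 𝔸)‖ ≤ 1)
    -- (3.37) for the exponent field, blockwise, in the shapes files 1–3 and §3 read it
    (h337B : ∀ ν k x, ‖((g.eta : ℂ)⁻¹) • covDstar T U ν (A k) x‖ ≤ α₁ * (g.len (blk x) ^ 2)⁻¹)
    (h337F : ∀ μ ν x, ‖((g.eta : ℂ)⁻¹) • covD T U μ (A ν) x‖ ≤ α₁ * (g.len (blk x) ^ 2)⁻¹)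
    (h337B' : ∀ μ ν x, ‖((g.eta : ℂ)⁻¹) • covDstar T U ν (A ν) (T μ x)‖ ≤ α₁ * (g.len (blk x) ^ 2)⁻¹)
    (hAst : ∀ μ x m z, (m, z) ∈ stBonds T μ x → ‖A m z‖ ≤ α₁ * (g.len (blk x))⁻¹)
    (hAloc : ∀ μ x m z, (m, z) ∈ B9Eq375Locality.locBondsA T μ x → ‖A m z‖ ≤ α₁ * (g.len (blk x))⁻¹)
    (hdAst : ∀ μ x m n y, Through T μ x m n y →
      ‖covD T U m (A n) y‖ ≤ g.eta * (α₁ * ((g.len (blk x))⁻¹) ^ 2) ∧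
        ‖covD T U n (A m) y‖ ≤ g.eta * (α₁ * ((g.len (blk x))⁻¹) ^ 2))
    (h35 : ∀ μ x m n y, Through T μ x m n y → ‖(plaqU T U m n y : 𝔸) - 1‖ ≤ C₀ * ((g.L ^ g.scale (blk x))⁻¹) ^ 2)
    -- stencil geometry
    (hd₀B : ∀ μ x, g.dist (blk x) (blk ((T μ).symm x)) ≤ d₀) (hd₀F : ∀ μ x, g.dist (blk x) (blk (T μ x)) ≤ d₀)
    (hd₀FB : ∀ μ ν x, g.dist (blk x) (blk ((T ν).symm (T μ x))) ≤ d₀)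
    (hd₀st : ∀ μ x (q : κ × S), q ∈ stBonds T μ x → g.dist (blk x) (blk q.2) ≤ d₀)
    (hd₀loc : ∀ μ x (q : κ × S), q ∈ B9Eq375Locality.locBondsA' T μ x → g.dist (blk x) (blk q.2) ≤ d₀)
    (hd₀0 : ∀ y : g.Site, g.dist y y ≤ d₀) :
    HasMajorant (g := toB6 g Rr H) (fun q : (κ × S) × ι => blk q.1.2)
      (conj b (zeroLetter T U ((g.eta : ℂ)⁻¹) A + F₁Letter T U g.eta A)
        - conj b (dPrimeLetter T (prodCfg U g.eta A) g.eta - dPrimeLetter T U g.eta)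
        + conj b (zeroLetter₂ T U ((g.eta : ℂ)⁻¹) A + F₂Letter T U g.eta A))
      (fun y y' => (cV0 (Fintype.card κ) α₁ C₀ * M₂ * (∑ i, ‖b i‖) * Real.exp (δ * d₀)) * α₁ * (g.len y ^ 2)⁻¹ *
        Real.exp (-(δ * g.dist y y'))) := by
  have h1 := hasMajorant_V₁Op_zero (Rr := Rr) (H := H) b T U blk hη A 1 d₀ δ M₂ α₁ hα₁ hδ hM₂ hrepr hlen hsmall le_rfl hU1
    h337B hAst hd₀B hd₀st hd₀0
  have hΔ := hasMajorant_dPrimeDiff (Rr := Rr) (H := H) b T U blk hη hL A C₀ d₀ δ M₂ α₁ hα₁ hC₀ hδ hM₂ hrepr hU1 hAst hdAst h35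
    hd₀st hd₀0
  have h2 := hasMajorant_zeroLetter₂ (Rr := Rr) (H := H) b T U blk ((g.eta : ℂ)⁻¹) A 1 d₀ δ M₂ α₁ hα₁ hδ hM₂ hrepr h337F
    (fun ν x => h337B ν ν x) h337B' hU1 hd₀F hd₀B hd₀FB
  have h3 := hasMajorant_F₂Letter (Rr := Rr) (H := H) b T U blk hη A 1 d₀ δ M₂ α₁ hα₁ hδ hM₂ hrepr hlen hsmall le_rfl hU1 hAloc
    hd₀loc hd₀0
  rw [conj_add b (zeroLetter₂ T U _ A)]
  refine hasMajorant_mono (g := toB6 g Rr H) _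
    (hasMajorant_add (g := toB6 g Rr H) _ (hasMajorant_sub' (Rr := Rr) (H := H) _ h1 hΔ)
      (hasMajorant_add (g := toB6 g Rr H) _ h2 h3))
    fun y y' => le_of_eq ?_
  simp only [cV0, one_pow]
  ring

end Majorants

end Literature.MathematicalPhysics.QuantumFieldTheory.Balaban1983to89.B9Eq382V3Letters
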